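import Summits.QuantumFields.YangMills.Theorems.UnitScaleTiltMinimiserStabilityRegPrAttainmentOfLeaves
import Summits.QuantumFields.YangMills.Theorems.UnitScaleTiltMinimiserStabilityRegPrProp8Iter
import Summits.QuantumFields.YangMills.Theorems.UnitScaleTiltFluctuationComparisonRegPrIntLOnChi
import HarnessLib

/-!
# `UnitScaleTiltFluctuationComparisonRegPrIntLT8OfV7Leaves` — STUB T8 OF v5kC («[Balaban1985Variational] Thm 1 (global reading) ∧ its (8)-clause for every minimiser, at every odd
# block size») FROM THE TWO OPEN LEAVES OF CRUX `MinimiserStabilityRegPr`'s REGISTERED SKELETON v7, BY NAME (cruxes `FluctuationComparisonRegPrIntL` stmt-QuantumFields-20520 — skeleton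
# v5kC, OWNER RULING g23-№2 ADD. 7 — and `MinimiserStabilityRegPr` stmt-QuantumFields-19200 — skeleton v7 `Cruxes/MinimiserStabilityRegPr/Lines/birth_v7.lean` cc37a17877262141, stubs
# `stub_halvingStep` (V2′), `stub_prop7From14` (V3); width-lever lane B, seat ym-ust-19935-r1 g4)

OWNER ADD. 7: T8 «closes BY NAME from 19200's `variational_of_leaves_log` via `InteriorExcision.thm1In8_of_attained_of_in8`».  `variational_of_leaves_log` lives in the v7 SKELETON
(not importable); its ingredients are Theorems/Literature theorems: ★p1 g14's `Prop8Iter.prop8_of_halvingLiteral` (V2′ ⟹ `Prop8Printed`), ★p2's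
`Variational.minSixAttainedAt_of_prop7_prop8` (V3 ∧ V2 ⟹ `MinSixAttainedAt`), `T3Thm1Carrier.minimisersIn8At_of_prop8` (V2 ⟹ `MinimisersIn8At L a₅ a₁ B₃` for EVERY `a₁`), and
★r1 g3's `InteriorExcision.thm1In8_of_attained_of_in8` (common window `(min â₀ a₀, min â₁ a₁, B₃)`).  This file is their ONE composition in the tree:

* **`thm1In8GlobalMin_of_v7Leaves : ⟨stub_halvingStep TEXT⟩ → ⟨stub_prop7From14 TEXT⟩ → ⟨stub_thm1In8GlobalMin TEXT⟩`** (T8 of v5kC VERBATIM; the third leaf V4′ of v7 — the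
  log-Lipschitz curvature gradient — is NOT needed for T8).
So 20520's T8 is, BY NAME, 19200's two open printed leaves ([Balaban1985Variational] Prop. 7 from a background (14), and the Sect. F halving step of Prop. 8).  CONDITIONAL
composition; nothing of [Balaban1985Variational] is asserted; registry untouched (`--supports stmt-QuantumFields-20520`).

References: T. Bałaban, CMP 102 (1985) 277–309 [Balaban1985Variational] (Thm 1 (8) p.279, Prop. 7 p.299, Sect. F / Prop. 8 p.304).
-/

set_option autoImplicit false

noncomputable section

namespace Summit.QuantumFields.YangMills.Theorems.InteriorExcision

open Literature.MathematicalPhysics.QuantumFieldTheory.Balaban1983to89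
open Literature.MathematicalPhysics.QuantumFieldTheory.Balaban1983to89.T3ContinuumYM3Torus
open Literature.MathematicalPhysics.QuantumFieldTheory.Balaban1983to89.T3PrintedMinimiserExistence
open Literature.MathematicalPhysics.QuantumFieldTheory.Balaban1983to89.T3LowerAlongMinimisersSplit (MinimisersIn8At)
open Literature.MathematicalPhysics.QuantumFieldTheory.Balaban1983to89.T3ExistSplit (MinSixAttainedAt)
open Literature.MathematicalPhysics.QuantumFieldTheory.Balaban1983to89.T3Thm1Carrier (famX Idx minimisersIn8At_of_prop8)
open Literature.MathematicalPhysics.QuantumFieldTheory.Balaban1983to89.B11 (Prop8Printed)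

/-- **STUB T8 OF v5kC FROM THE TWO OPEN LEAVES OF `MinimiserStabilityRegPr`'s v7, BY NAME.**  Hypotheses = the registered texts of `stub_halvingStep` (V2′: the Sect. F halving step
of [Balaban1985Variational] Prop. 8 at the d = 3 carriers, one `B₃ > 4`) and `stub_prop7From14` (V3: Prop. 7 from a background (14), for every `B₃ > 4`) VERBATIM; conclusion = the
text of `stub_thm1In8GlobalMin` VERBATIM: for every odd `L > 1` a common window `(a₀, a₁, B₃)` with `Thm1GlobalMinAt L a₀ a₁ B₃ ∧ MinimisersIn8At L a₀ a₁ B₃`.  Chain: V2′ ⟹ Prop 8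
(`Prop8Iter.prop8_of_halvingLiteral`) ⟹ attainment over (6) with V3 (`Variational.minSixAttainedAt_of_prop7_prop8`) and «minimisers lie in (8)» (`minimisersIn8At_of_prop8`, at
`a₁ := â₁`) ⟹ T8 at the common window (`thm1In8_of_attained_of_in8`).  `Odd L` is not used. [cite: Balaban1985Variational, Thm 1 (8) p.279, Prop. 7 p.299, Prop. 8 p.304] -/
theorem thm1In8GlobalMin_of_v7Leaves
    (hV2 : ∀ (L : ℕ), 1 < L → ∃ B₃ : ℝ, 4 < B₃ ∧ ∃ a₅ : ℝ, 0 < a₅ ∧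
      ∀ (i : Idx L) (ε₀ ε₁ : ℝ), 0 < ε₁ → ∀ (V : (famX L i).Bdry) (U : (famX L i).Cfg), (famX L i).Reg7 ε₁ V → (famX L i).InU ε₀ U →
        (famX L i).InB V U → (famX L i).IsCritical V U → ε₀ ≤ a₅ → (famX L i).InU (max (B₃ * ε₁) (ε₀ / 2)) U)
    (hV3 : ∀ (L : ℕ), 1 < L → ∀ B₃ : ℝ, 4 < B₃ →
      ∃ a₀ a₁' O₁ : ℝ, 0 < a₀ ∧ 0 < a₁' ∧ 1 ≤ O₁ ∧ ∀ (i : Idx L) (ε₀ ε₁ : ℝ), 0 < ε₁ → ∀ V : (famX L i).Bdry, (famX L i).Reg7 ε₁ V →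
        ∀ U₀ : (famX L i).Cfg, (famX L i).InU ((L : ℝ) ^ 3 * B₃ * ε₁) U₀ → (famX L i).InB V U₀ →
          (ε₀ ≤ a₀ → B₃ * ε₁ ≤ ε₀ → (famX L i).AtMostOneCriticalOrbit ε₀ V) ∧
          (ε₁ ≤ a₁' → ∃ U : (famX L i).Cfg, (famX L i).OnMinimalOrbit (O₁ * (L : ℝ) ^ 3 * B₃ * ε₁) V U)) :
    ∀ L : ℕ, Odd L → 1 < L → ∃ a₀ a₁ B₃ : ℝ, 0 < a₀ ∧ 0 < a₁ ∧ 0 < B₃ ∧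
      Thm1GlobalMinAt L a₀ a₁ B₃ ∧ MinimisersIn8At L a₀ a₁ B₃ := by
  intro L _ hL
  obtain ⟨B₃, hB₃, h8⟩ := Summit.QuantumFields.YangMills.Theorems.Prop8Iter.prop8_of_halvingLiteral hV2 L hL
  have hB₃0 : 0 < B₃ := by linarith
  obtain ⟨â₀, â₁, hâ₀, hâ₁, hatt⟩ := Summit.QuantumFields.YangMills.Theorems.Variational.minSixAttainedAt_of_prop7_prop8 hL hB₃ (hV3 L hL B₃ hB₃) h8
  obtain ⟨a₅, ha₅, h8'⟩ := minimisersIn8At_of_prop8 hB₃0 h8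
  exact thm1In8_of_attained_of_in8 hâ₀ hâ₁ ha₅ hâ₁ hB₃0 hatt (h8' â₁)

end Summit.QuantumFields.YangMills.Theorems.InteriorExcision

end
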